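/-
Copyright (c) 2026 the pub-hodgecm-mathlib formalisation cell (harness21).  Prover seat hodgecm-mathlib-LH5-p03 (g7); dealer LH4-plan (g7) (LAYER C (C4), fixed-point
assembly, file C4-2), 2026-09-02.  Count-neutral base layer of the dyadic (D-UNR) column (FINDINGS #6∕#6′ of the LH4 board).
-/
import Literature.NumberTheory.Automorphic.UnitaryThreeFixedPointsCountTrace                -- ★ p851921 C4-1 (this seat): Cor. 9 counted for `u_m^{(y,z)}`
import Literature.NumberTheory.Automorphic.UnitaryThreeTorusDoubleCosetsHKTrace             -- ★ F2 (LH4-p03 (g8) ∕ LH4-p01 (g6)): Prop. 6 (a) `hA` for the trace torus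
import Literature.NumberTheory.Automorphic.UnitaryThreeTorusDoubleCosetsHKDisjointTrace     -- ★ F3 (LH3-p01 (g7)): Prop. 6 (b) `hB`
import Literature.NumberTheory.Automorphic.UnitaryThreeTorusDoubleCosetsHKWeightTrace       -- ★ F4 (LH5-p01 (g5)): Prop. 6 (c)∕7 the weight
import HarnessLib

/-!
# Flicker's Cor. 9 ASSEMBLED at the TRACE-FRAME torus, for the 2-free level elements `u_m^{(y,z)}`:
# `#{x ∈ H ⧸ H^K_m : t·x = x} = Σᶠᵢ w(2i+ε) · #{w ∈ P_H ⧸ (P_H ∩ H^K_m) : w̃⁻¹ (rᵢ⁻¹ t rᵢ) w̃ ∈ H^K_m}`, `w(0) = 1`, `w(j) = (q₀+1)·q₀^{j−1}` — every residue characteristic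
(Flicker 1998, Cor. 9 p. 85, with Prop. 6 p. 83 and Prop. 8 p. 84)

Topic `NumberTheory/Automorphic`; namespace `Literature.NumberTheory.Automorphic.UnitaryGroup`.  ONE THEOREM (no `def`, no instance, no notation, no named fact, no `sorry`;
one `synthInstance.maxHeartbeats` bump for the `MulAction` instance on `↥H ⧸ M`, as ★).  Cell `pub/hodgecm-mathlib`, crux H413 = `stmt-HodgeConjecture-24833`; LH4 board
(D-UNR), LAYER C block (C4), file C4-2 of CENSUS-C4 684e921fb7106247 §4 (= (C0b) of CENSUS-C5 bd72510a61456e21 §0.6), dealer LH4-plan (g7) WORD #15: the TWIN of ★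
`UnitaryThreeFixedPointsCountTheta.natCard_fixedPoints_flickerTorus_eq_finsum` (B-p04, Flicker frame) — ★ C4-1 `natCard_fixedPoints_centralizer_eq_finsum_of_rel` with `hA` ∕ `hB` ∕
the weight DISCHARGED by the LAYER B 3∕3 trace bricks F2 (Prop. 6 (a)) ∕ F3 (Prop. 6 (b)) ∕ F4 (Prop. 6 (c)) at the trace torus block
`t = M(x₁,x₂,x₃) = !![x₁σb + x₃b, 0, π(x₁ − x₃); 0, x₂, 0; π′bσb(x₁ − x₃), 0, x₁b + x₃σb]` (`b + σb = 1`, `|b| ≤ 1`, `ππ′ = 1`, `π = ϖ^ε`, `ε ≤ 1`), bridge `(R, ι, σR)` with ring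
generator `gR` (`σR gR − gR ∈ Rˣ`, T1), datum `UnramifiedLocalConjDatum σ ϖ` + `(2 : K) ≠ 0` (T2).  The WEIGHTS `w(2i+ε)` are Flicker's, VERBATIM, at every residue characteristic
(CENSUS-LAYERB-3of3 4277d501 §0.1 ∕ §2 (iii)); what remains hypothetical is ONLY the finiteness `hfin` (supplied downstream from the global finiteness through the (C0a) twin of ★
`finite_setOf_nonempty_fixedPoints_flickerU`).  HONEST LABEL: HC_CM is proved only modulo the printed citations (hLiu418 = `stmt-HodgeConjecture-24832`, h413 =
`stmt-HodgeConjecture-24833`) until rung 0 closes; structure theory, pays no organ, opens no road ((D-UNR) stays PRINT by D74′).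

## References
* [Flicker1998UnitaryFL] Y. Z. Flicker, *Elementary proof of the fundamental lemma for a unitary group*, Canad. J. Math. 50 (1998), Prop. 6 p. 83, Prop. 8 p. 84, Cor. 9 p. 85.
-/

set_option autoImplicit false

open scoped MatrixGroups WithZero
open Matrix

namespace Literature.NumberTheory.Automorphic

namespace UnitaryGroup

open Literature.NumberTheory.Automorphic.HermitianLattice (unitaryInt mem_unitaryInt_iff UnramifiedLocalConjDatum)
open IsLocalRing

universe u

section TraceTorus

variable {K : Type*} [Field K] [Valued K ℤᵐ⁰] {ϖ : K} (σ : K →+* K) {J : Matrix (Fin 3) (Fin 3) K}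

set_option synthInstance.maxHeartbeats 120000 in
/-- **FLICKER'S COR. 9 AT THE TRACE TORUS, ASSEMBLED** (type (1), `π = ϖ^ε`, `ε ∈ {0,1}`, every residue characteristic): for the trace torus block
`t = !![x₁σb + x₃b, 0, π(x₁ − x₃); 0, x₂, 0; π′bσb(x₁ − x₃), 0, x₁b + x₃σb] ∈ H`, `T = Z_H(t)`, the radial representatives `rᵢ = diag(ϖ^{−i}, 1, ϖ^{i})`, the 2-free level
element `u = u_m^{(y,z)}` and finitely many fixed points,
`#{x ∈ H ⧸ H^K_m : t·x = x} = Σᶠᵢ w(2i+ε) · #{w ∈ P_H ⧸ (P_H ∩ H^K_m) : w̃⁻¹ (rᵢ⁻¹ t rᵢ) w̃ ∈ H^K_m}` with `w(0) = 1`, `w(j) = (q₀+1)q₀^{j−1}` — ★ C4-1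
`natCard_fixedPoints_centralizer_eq_finsum_of_rel` with `hA` ∕ `hB` ∕ the weight DISCHARGED by ★ F2∕F3∕F4.  Twin of ★ `natCard_fixedPoints_flickerTorus_eq_finsum`; conclusion =
its, byte for byte, with `um ↦ u`. [cite: Flicker1998UnitaryFL, Cor. 9 p. 85; Prop. 6 p. 83; Prop. 8 p. 84] -/
theorem natCard_fixedPoints_traceTorus_eq_finsum (hJ : J = (StdForm.antidiagonal 3).over K) (hd : UnramifiedLocalConjDatum σ ϖ) (h2 : (2 : K) ≠ 0)
    {y z : K} (hy : Valued.v y = 1) (hzv : Valued.v z ≤ 1) (hz : z + σ z + y * σ y = 0) (m : ℕ)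
    {u : ↥(unitaryGroupOfForm σ J)}
    (hu : ((u : GL (Fin 3) K) : Matrix (Fin 3) (Fin 3) K) = !![ϖ ^ m, y, z * (ϖ ^ m)⁻¹; 0, 1, -σ y * (ϖ ^ m)⁻¹; 0, 0, (ϖ ^ m)⁻¹])
    {R : Type u} [CommRing R] [IsDomain R] [IsDiscreteValuationRing R] [Finite (ResidueField R)] (ι : R →+* K) (hι : Function.Injective ι)
    (hιv : ∀ x : K, Valued.v x ≤ 1 ↔ x ∈ Set.range ι) (σR : R →+* R) (hσR : ∀ r, σR (σR r) = r) (hσι : ∀ r, ι (σR r) = σ (ι r))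
    {gR : R} (hgR : IsUnit (σR gR - gR)) {ϖR : R} (hϖR : Irreducible ϖR) (hιϖ : ι ϖR = ϖ)
    {q₀ : ℕ} (hq : Nat.card (ResidueField R) = q₀ ^ 2)
    {c : ↥(unitaryGroupOfForm σ J)} (hc : ((c : GL (Fin 3) K) : Matrix (Fin 3) (Fin 3) K) = !![1, 0, 0; 0, -1, 0; 0, 0, 1])
    {ε : ℕ} (hε : ε ≤ 1) {π π' : K} (hππ : π * π' = 1) (hπε : π = ϖ ^ ε) {b : K} (hb : b + σ b = 1) (hbv : Valued.v b ≤ 1)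
    {t : ↥(unitaryGroupOfForm σ J)} (htH : t ∈ Subgroup.centralizer ({c} : Set ↥(unitaryGroupOfForm σ J))) {x₁ x₂ x₃ : K}
    (hte : ((t : GL (Fin 3) K) : Matrix (Fin 3) (Fin 3) K) =
      !![x₁ * σ b + x₃ * b, 0, π * (x₁ - x₃); 0, x₂, 0; π' * (b * σ b * (x₁ - x₃)), 0, x₁ * b + x₃ * σ b]) (hx : x₁ ≠ x₃)
    (r : ℕ → ↥(Subgroup.centralizer ({c} : Set ↥(unitaryGroupOfForm σ J))))
    (hr : ∀ i, (((r i : ↥(unitaryGroupOfForm σ J)) : GL (Fin 3) K) : Matrix (Fin 3) (Fin 3) K) = !![(ϖ ^ i)⁻¹, 0, 0; 0, 1, 0; 0, 0, ϖ ^ i])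
    (hfin : {x : ↥(Subgroup.centralizer ({c} : Set ↥(unitaryGroupOfForm σ J))) ⧸
        (flickerHK σ J c u).subgroupOf (Subgroup.centralizer ({c} : Set ↥(unitaryGroupOfForm σ J))) |
      (⟨t, htH⟩ : ↥(Subgroup.centralizer ({c} : Set ↥(unitaryGroupOfForm σ J)))) • x = x}.Finite) :
    Nat.card {x : ↥(Subgroup.centralizer ({c} : Set ↥(unitaryGroupOfForm σ J))) ⧸
        (flickerHK σ J c u).subgroupOf (Subgroup.centralizer ({c} : Set ↥(unitaryGroupOfForm σ J))) //
        (⟨t, htH⟩ : ↥(Subgroup.centralizer ({c} : Set ↥(unitaryGroupOfForm σ J)))) • x = x} =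
      ∑ᶠ i : ℕ, (if 2 * i + ε = 0 then 1 else (q₀ + 1) * q₀ ^ (2 * i + ε - 1)) *
        Nat.card {w : ↥(flickerPH σ J c) ⧸ (flickerHK σ J c u).subgroupOf (flickerPH σ J c) //
          ((Quotient.out w : ↥(flickerPH σ J c)) : ↥(unitaryGroupOfForm σ J))⁻¹ *
              (((r i)⁻¹ * ⟨t, htH⟩ * r i : ↥(Subgroup.centralizer ({c} : Set ↥(unitaryGroupOfForm σ J)))) : ↥(unitaryGroupOfForm σ J)) *
            (Quotient.out w : ↥(flickerPH σ J c)) ∈ flickerHK σ J c u} := by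
  have ht' : ∀ τ ∈ Subgroup.centralizer ({⟨t, htH⟩} : Set ↥(Subgroup.centralizer ({c} : Set ↥(unitaryGroupOfForm σ J)))),
      τ * ⟨t, htH⟩ = ⟨t, htH⟩ * τ := fun τ hτ => Subgroup.mem_centralizer_singleton_iff.1 hτ
  rw [natCard_fixedPoints_centralizer_eq_finsum_of_rel σ hJ hd h2 hy hzv hz m hu hc r ⟨t, htH⟩ _ ht'
    (exists_mem_centralizer_mul_diagRadial_mul_mem_flickerKH_traceTorus σ hJ hd h2 ι hι hιv σR hσR hσι hgR hϖR hιϖ hc hε hπε hππ hb hbv htH hte r hr)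
    (eq_of_centralizer_mul_diagRadial_mul_flickerKH_eq_trace σ hJ hd h2 hc hb hbv hππ hπε htH hx hte r hr) hfin]
  refine finsum_congr fun i => ?_
  rw [relIndex_flickerKH_conj_diagRadial_traceTorus_eq σ hJ hd h2 ι hι hιv σR hσR hσι hgR hϖR hιϖ hq hc hπε hππ hb hbv htH hte hx r hr i]

end TraceTorus

end UnitaryGroup

end Literature.NumberTheory.Automorphic
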